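import Mathlib
import Summits.PneNP.PneNP.Theorems.OverlapGapAlgebraSearchHardWindowAffineRungCore

/-!
# PneNP / OverlapGapAlgebra — `SearchHardWindow`: the ALGEBRAIC (sign-affine) rung (2/3) —
# the GF(2) elimination count and the exact finite bound

Support for crux `stmt-PneNP-2460` (`Summit.PneNP.PneNP.Theses.OverlapGapAlgebra.SearchHardWindow`)
and for the calibration of crux `stmt-PneNP-2463`. Sequel of `…AffineRungCore` (see its header
for the statement of the rung and why the algebraic class is the one the OGP method cannot touch).

* `shwAff_core_count` — THE INDUCTION. For ternary-affine functionals `t v` of the sign vector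
  (`v : Fin n`, at most `N` of them non-constant), a variable skeleton `var` and a clause set `A`:
  `#{b : ∀ i ∈ A, ∃ j, t (var (i,j)) b = b (i,j)} ≤ 2^{mk} (1 - 2^{-k})^{#A - N}`.
  Step: pick a non-constant `t v₀` and a slot `e` it depends on; the involution `θ b = b[e ↦ t v₀ b]`
  re-parametrises the sign cube so that `t v₀` becomes a free bit `u`; for each `u` the
  substituted system `t ∘ R_u` is again affine with `t v₀ ∘ R_u ≡ u` (one fewer non-constant
  functional) and success of the original system at `R_u b` forces success of the substituted one
  off the clause of `e`; the halving lemma turns the re-parametrisation into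
  `2·#S = #Q_true + #Q_false`. No linear algebra is used.
* `shwAff_successCount_le_of_dep`, `shwAff_successCount_le` — the instance-level bound for a
  SIGN-AFFINE search map `g` (for every skeleton `S`, `signs ↦ g (S ⊗ signs)` preserves `x ⊕ y ⊕ z`
  output bit by output bit): `#{Φ : g Φ ⊨ Φ} ≤ (1 - 2^{-k})^{m - N} #Inst` when at most `N` output
  bits depend on the signs (`N = n` always; `N = 0` recovers the sign-oblivious rung
  `shwS_ratio_eq`);
(Families of maps, ratio / exponential forms and the asymptotic rung: `…AffineRung`.)
No definitions; axioms `propext`, `Classical.choice`, `Quot.sound`.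
-/

set_option linter.dupNamespace false -- `Summit.PneNP.PneNP.…`: summit = sub-problem (D-0017)

namespace Summit.PneNP.PneNP.Theorems

open Finset Filter
open scoped Classical

section Count

variable {m k n : ℕ}

/-- **Core count (the induction).** Let `t v` (`v : Fin n`) be ternary-affine Boolean functionals
of the sign vector, at most `N` of them non-constant, and `var` a variable skeleton. Then the number
of sign vectors `b` such that every clause `i ∈ A` has a slot `j` with `t (var (i,j)) b = b (i,j)`
is at most `2^{mk} (1 - 2^{-k})^{#A - N}`. -/
theorem shwAff_core_count (var : Fin m × Fin k → Fin n) (N : ℕ) :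
    ∀ (A : Finset (Fin m)) (t : Fin n → (Fin m × Fin k → Bool) → Bool),
      (∀ v (x y z : Fin m × Fin k → Bool),
        t v (fun e => (x e ^^ y e) ^^ z e) = ((t v x ^^ t v y) ^^ t v z)) →
      ((univ : Finset (Fin n)).filter fun v => ∃ b, t v b ≠ t v (fun _ => false)).card ≤ N →
      (((univ : Finset (Fin m × Fin k → Bool)).filter fun b =>
          ∀ i ∈ A, ∃ j, t (var (i, j)) b = b (i, j)).card : ℝ) ≤
        2 ^ (m * k) * (1 - (2 : ℝ)⁻¹ ^ k) ^ (A.card - N) := by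
  have hρ0 : (0 : ℝ) ≤ 1 - (2 : ℝ)⁻¹ ^ k := by
    rw [sub_nonneg]
    exact pow_le_one₀ (by norm_num) (by norm_num)
  have hρ1 : 1 - (2 : ℝ)⁻¹ ^ k ≤ 1 := sub_le_self _ (by positivity)
  induction N with
  | zero =>
    intro A t ht hN
    have hconst : ∀ v b, t v b = t v (fun _ => false) := by
      intro v b
      by_contra h
      have hv : v ∈ (univ : Finset (Fin n)).filter fun v => ∃ b, t v b ≠ t v (fun _ => false) := by
        simp only [mem_filter, mem_univ, true_and]
        exact ⟨b, h⟩
      rw [Nat.le_zero, card_eq_zero] at hN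
      rw [hN] at hv
      simp at hv
    have heq : ((univ : Finset (Fin m × Fin k → Bool)).filter fun b =>
        ∀ i ∈ A, ∃ j, t (var (i, j)) b = b (i, j)) =
        (univ : Finset (Fin m × Fin k → Bool)).filter fun b =>
          ∀ i ∈ A, ∃ j, t (var (i, j)) (fun _ => false) = b (i, j) := by
      refine filter_congr fun b _ => ?_
      simp only [hconst _ b]
    have hbase := shwAff_card_base_real A (fun e => t (var e) fun _ => false)
    rw [heq, Nat.sub_zero]
    exact hbase.le
  | succ N ih =>
    intro A t ht hN
    by_cases hc : ((univ : Finset (Fin n)).filter fun v =>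
        ∃ b, t v b ≠ t v (fun _ => false)).card ≤ N
    · refine (ih A t ht hc).trans ?_
      exact mul_le_mul_of_nonneg_left (pow_le_pow_of_le_one hρ0 hρ1 (by omega)) (by positivity)
    -- a non-constant functional `t v₀` and a slot `e` it depends on
    have hlt : N < ((univ : Finset (Fin n)).filter fun v =>
        ∃ b, t v b ≠ t v (fun _ => false)).card := not_le.mp hc
    obtain ⟨v₀, hv₀⟩ := Finset.card_pos.1 (lt_of_le_of_lt (Nat.zero_le N) hlt)
    have hnc : ∃ b, t v₀ b ≠ t v₀ (fun _ => false) := by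
      simpa using hv₀
    obtain ⟨e, he⟩ := shwAff_exists_dep (t v₀) (ht v₀) hnc
    have hflip : ∀ b, t v₀ b = (b e ^^ t v₀ (Function.update b e false)) :=
      shwAff_flip_dep (t v₀) (ht v₀) e he
    -- the substitution `R u b = b[e ↦ u ⊕ t v₀ (b[e ↦ false])]`
    set R : Bool → (Fin m × Fin k → Bool) → (Fin m × Fin k → Bool) :=
      fun u b => Function.update b e (u ^^ t v₀ (Function.update b e false)) with hR
    have hRoff : ∀ u b (i' : Fin m × Fin k), i' ≠ e → R u b i' = b i' := by
      intro u b i' hi'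
      simp only [hR, Function.update_of_ne hi']
    have hRupd : ∀ u b c, R u (Function.update b e c) = R u b := by
      intro u b c
      simp only [hR, Function.update_idem]
    have htR : ∀ u b, t v₀ (R u b) = u := by
      intro u b
      simp only [hR]
      exact shwAff_tau_R (t v₀) e hflip u b
    have hθ : ∀ b, Function.update b e (t v₀ b) = R (b e) b := by
      intro b
      simp only [hR]
      exact shwAff_theta_eq_R (t v₀) e hflip b
    have hθθ : ∀ b, Function.update (Function.update b e (t v₀ b)) e
        (t v₀ (Function.update b e (t v₀ b))) = b :=
      fun b => shwAff_theta_invol (t v₀) e hflip b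
    -- the substituted functionals are ternary-affine, with one fewer non-constant
    have ht' : ∀ u v (x y z : Fin m × Fin k → Bool),
        t v (R u (fun i => (x i ^^ y i) ^^ z i)) = ((t v (R u x) ^^ t v (R u y)) ^^ t v (R u z)) := by
      intro u v x y z
      simp only [hR]
      exact shwAff_comp_R_affine (t v₀) (t v) (ht v₀) (ht v) e u x y z
    have hN' : ∀ u, ((univ : Finset (Fin n)).filter fun v =>
        ∃ b, t v (R u b) ≠ t v (R u (fun _ => false))).card ≤ N := by
      intro u
      have hsub : ((univ : Finset (Fin n)).filter fun v =>
          ∃ b, t v (R u b) ≠ t v (R u (fun _ => false))) ⊆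
          ((univ : Finset (Fin n)).filter fun v => ∃ b, t v b ≠ t v (fun _ => false)).erase v₀ := by
        intro v hv
        simp only [mem_filter, mem_univ, true_and] at hv
        obtain ⟨b, hb⟩ := hv
        rw [mem_erase]
        refine ⟨?_, ?_⟩
        · rintro rfl
          exact hb (by rw [htR, htR])
        · simp only [mem_filter, mem_univ, true_and]
          by_cases h1 : t v (R u b) = t v (fun _ => false)
          · exact ⟨R u (fun _ => false), fun h2 => hb (h1.trans h2.symm)⟩
          · exact ⟨R u b, h1⟩
      calc ((univ : Finset (Fin n)).filter fun v =>
              ∃ b, t v (R u b) ≠ t v (R u (fun _ => false))).card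
          ≤ (((univ : Finset (Fin n)).filter fun v =>
              ∃ b, t v b ≠ t v (fun _ => false)).erase v₀).card := card_le_card hsub
        _ = ((univ : Finset (Fin n)).filter fun v =>
              ∃ b, t v b ≠ t v (fun _ => false)).card - 1 := card_erase_of_mem hv₀
        _ ≤ N := by omega
    -- induction hypothesis for the substituted system, off clause `e.1`
    have hIH : ∀ u, (((univ : Finset (Fin m × Fin k → Bool)).filter fun b =>
        ∀ i ∈ A.erase e.1, ∃ j, t (var (i, j)) (R u b) = b (i, j)).card : ℝ) ≤
          2 ^ (m * k) * (1 - (2 : ℝ)⁻¹ ^ k) ^ ((A.erase e.1).card - N) :=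
      fun u => ih (A.erase e.1) (fun v b => t v (R u b)) (ht' u) (hN' u)
    have hexp : (2 : ℝ) ^ (m * k) * (1 - (2 : ℝ)⁻¹ ^ k) ^ ((A.erase e.1).card - N) ≤
        2 ^ (m * k) * (1 - (2 : ℝ)⁻¹ ^ k) ^ (A.card - (N + 1)) := by
      refine mul_le_mul_of_nonneg_left (pow_le_pow_of_le_one hρ0 hρ1 ?_) (by positivity)
      have := pred_card_le_card_erase (s := A) (a := e.1)
      omega
    -- success after substitution implies success of the substituted system off clause `e.1`
    have hincl : ∀ u, ((univ : Finset (Fin m × Fin k → Bool)).filter fun b =>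
          ∀ i ∈ A, ∃ j, t (var (i, j)) (R u b) = R u b (i, j)) ⊆
        ((univ : Finset (Fin m × Fin k → Bool)).filter fun b =>
          ∀ i ∈ A.erase e.1, ∃ j, t (var (i, j)) (R u b) = b (i, j)) := by
      intro u b hb
      simp only [mem_filter, mem_univ, true_and] at hb ⊢
      intro i hi
      rw [mem_erase] at hi
      obtain ⟨j, hj⟩ := hb i hi.2
      refine ⟨j, ?_⟩
      rw [hRoff u b (i, j) (fun h => hi.1 (by rw [← h]))] at hj
      exact hj
    have hQ : ∀ u, (((univ : Finset (Fin m × Fin k → Bool)).filter fun b =>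
        ∀ i ∈ A, ∃ j, t (var (i, j)) (R u b) = R u b (i, j)).card : ℝ) ≤
          2 ^ (m * k) * (1 - (2 : ℝ)⁻¹ ^ k) ^ (A.card - (N + 1)) := by
      intro u
      calc (((univ : Finset (Fin m × Fin k → Bool)).filter fun b =>
              ∀ i ∈ A, ∃ j, t (var (i, j)) (R u b) = R u b (i, j)).card : ℝ)
          ≤ (((univ : Finset (Fin m × Fin k → Bool)).filter fun b =>
              ∀ i ∈ A.erase e.1, ∃ j, t (var (i, j)) (R u b) = b (i, j)).card : ℝ) := by
            exact_mod_cast card_le_card (hincl u)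
        _ ≤ _ := (hIH u).trans hexp
    -- the counting identity `2 · #S = #Q_true + #Q_false`
    have h1 : ((univ : Finset (Fin m × Fin k → Bool)).filter fun b =>
          ∀ i ∈ A, ∃ j, t (var (i, j)) b = b (i, j)).card =
        ((univ : Finset (Fin m × Fin k → Bool)).filter fun b =>
          ∀ i ∈ A, ∃ j, t (var (i, j)) (Function.update b e (t v₀ b)) =
            Function.update b e (t v₀ b) (i, j)).card := by
      refine (Finset.card_bij' (fun b _ => Function.update b e (t v₀ b))
        (fun b _ => Function.update b e (t v₀ b)) ?_ ?_ ?_ ?_).symm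
      · intro b hb
        simp only [mem_filter, mem_univ, true_and] at hb ⊢
        exact hb
      · intro b hb
        simp only [mem_filter, mem_univ, true_and] at hb ⊢
        rw [hθθ b]
        exact hb
      · intro b _
        exact hθθ b
      · intro b _
        exact hθθ b
    have h2 : ((univ : Finset (Fin m × Fin k → Bool)).filter fun b =>
          ∀ i ∈ A, ∃ j, t (var (i, j)) (Function.update b e (t v₀ b)) =
            Function.update b e (t v₀ b) (i, j)).card =
        ((univ : Finset (Fin m × Fin k → Bool)).filter fun b =>
          b e = true ∧ ∀ i ∈ A, ∃ j, t (var (i, j)) (R true b) = R true b (i, j)).card +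
        ((univ : Finset (Fin m × Fin k → Bool)).filter fun b =>
          b e = false ∧ ∀ i ∈ A, ∃ j, t (var (i, j)) (R false b) = R false b (i, j)).card := by
      rw [← Finset.card_filter_add_card_filter_not (s := (univ : Finset (Fin m × Fin k → Bool)).filter
        fun b => ∀ i ∈ A, ∃ j, t (var (i, j)) (Function.update b e (t v₀ b)) =
          Function.update b e (t v₀ b) (i, j)) (fun b => b e = true), filter_filter, filter_filter]
      congr 1
      · congr 1
        refine filter_congr fun b _ => ?_
        constructor
        · rintro ⟨hP, hbe⟩
          rw [hθ b, hbe] at hP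
          exact ⟨hbe, hP⟩
        · rintro ⟨hbe, hP⟩
          rw [hθ b, hbe]
          exact ⟨hP, rfl⟩
      · congr 1
        refine filter_congr fun b _ => ?_
        simp only [Bool.not_eq_true]
        constructor
        · rintro ⟨hP, hbe⟩
          rw [hθ b, hbe] at hP
          exact ⟨hbe, hP⟩
        · rintro ⟨hbe, hP⟩
          rw [hθ b, hbe]
          exact ⟨hP, rfl⟩
    have h3 : ∀ u, 2 * ((univ : Finset (Fin m × Fin k → Bool)).filter fun b =>
          b e = u ∧ ∀ i ∈ A, ∃ j, t (var (i, j)) (R u b) = R u b (i, j)).card =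
        ((univ : Finset (Fin m × Fin k → Bool)).filter fun b =>
          ∀ i ∈ A, ∃ j, t (var (i, j)) (R u b) = R u b (i, j)).card := by
      intro u
      refine shwAff_card_halve e (fun b => ∀ i ∈ A, ∃ j, t (var (i, j)) (R u b) = R u b (i, j))
        (fun b c => ?_) u
      rw [hRupd]
    have hcount : 2 * ((univ : Finset (Fin m × Fin k → Bool)).filter fun b =>
          ∀ i ∈ A, ∃ j, t (var (i, j)) b = b (i, j)).card =
        ((univ : Finset (Fin m × Fin k → Bool)).filter fun b =>
          ∀ i ∈ A, ∃ j, t (var (i, j)) (R true b) = R true b (i, j)).card +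
        ((univ : Finset (Fin m × Fin k → Bool)).filter fun b =>
          ∀ i ∈ A, ∃ j, t (var (i, j)) (R false b) = R false b (i, j)).card := by
      rw [h1, h2, mul_add, h3 true, h3 false]
    have hreal : (2 : ℝ) * ((univ : Finset (Fin m × Fin k → Bool)).filter fun b =>
          ∀ i ∈ A, ∃ j, t (var (i, j)) b = b (i, j)).card =
        (((univ : Finset (Fin m × Fin k → Bool)).filter fun b =>
          ∀ i ∈ A, ∃ j, t (var (i, j)) (R true b) = R true b (i, j)).card : ℝ) +
        (((univ : Finset (Fin m × Fin k → Bool)).filter fun b =>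
          ∀ i ∈ A, ∃ j, t (var (i, j)) (R false b) = R false b (i, j)).card : ℝ) := by
      exact_mod_cast hcount
    linarith [hQ true, hQ false, hreal]

end Count

section Instance

variable {m k n : ℕ}

/-- **Sign-affine maps with few sign-dependent output bits: the exact finite bound.** If for every
variable skeleton `S` the map `signs ↦ g (S ⊗ signs)` is GF(2)-affine (ternary-xor preserving,
output bit by output bit) and at most `N` of its output bits actually depend on the signs, then
`#{Φ : g Φ satisfies Φ} ≤ (1 - 2^{-k})^{m - N} · #Inst`. (`N = 0` is the sign-oblivious rung.) -/
theorem shwAff_successCount_le_of_dep (N : ℕ) (g : (Fin m → Fin k → Fin n × Bool) → (Fin n → Bool))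
    (hg : ∀ (S : Fin m → Fin k → Fin n) (x y z : Fin m → Fin k → Bool) (v : Fin n),
      g (fun i j => (S i j, (x i j ^^ y i j) ^^ z i j)) v =
        ((g (fun i j => (S i j, x i j)) v ^^ g (fun i j => (S i j, y i j)) v) ^^
          g (fun i j => (S i j, z i j)) v))
    (hN : ∀ S : Fin m → Fin k → Fin n, ((univ : Finset (Fin n)).filter fun v =>
      ∃ b : Fin m × Fin k → Bool, g (fun i j => (S i j, b (i, j))) v ≠
        g (fun i j => (S i j, false)) v).card ≤ N) :
    (((univ : Finset (Fin m → Fin k → Fin n × Bool)).filter fun Φ =>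
        ∀ i, ∃ j, g Φ (Φ i j).1 = (Φ i j).2).card : ℝ) ≤
      (1 - (2 : ℝ)⁻¹ ^ k) ^ (m - N) * Fintype.card (Fin m → Fin k → Fin n × Bool) := by
  set G : Finset (Fin m → Fin k → Fin n × Bool) :=
    univ.filter fun Φ => ∀ i, ∃ j, g Φ (Φ i j).1 = (Φ i j).2 with hG
  set skel : (Fin m → Fin k → Fin n × Bool) → (Fin m → Fin k → Fin n) :=
    fun Φ i j => (Φ i j).1 with hskel
  -- fibre over a skeleton `S` ≃ sign vectors solving the affine system of `S`
  have hfib : ∀ S : Fin m → Fin k → Fin n, (G.filter fun Φ => skel Φ = S).card =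
      ((univ : Finset (Fin m × Fin k → Bool)).filter fun b =>
        ∀ i ∈ (univ : Finset (Fin m)), ∃ j,
          g (fun i' j' => (S i' j', b (i', j'))) (S i j) = b (i, j)).card := by
    intro S
    refine Finset.card_bij' (fun Φ _ => fun e => (Φ e.1 e.2).2)
      (fun b _ => fun i j => (S i j, b (i, j))) ?_ ?_ ?_ ?_
    · intro Φ hΦ
      simp only [hG, mem_filter, mem_univ, true_and, true_implies] at hΦ ⊢
      obtain ⟨hsat, hS⟩ := hΦ
      have hΦeq : (fun i j => (S i j, (Φ i j).2)) = Φ := by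
        funext i j
        rw [← hS]
      rw [hΦeq]
      intro i
      obtain ⟨j, hj⟩ := hsat i
      refine ⟨j, ?_⟩
      rw [← hS]
      exact hj
    · intro b hb
      simp only [hG, mem_filter, mem_univ, true_and, true_implies] at hb ⊢
      exact ⟨fun i => hb i, rfl⟩
    · intro Φ hΦ
      simp only [hG, mem_filter, mem_univ, true_and] at hΦ
      funext i j
      rw [← hΦ.2]
    · intro b _
      rfl
  -- each fibre obeys the core count with `A = univ`
  have hcore : ∀ S : Fin m → Fin k → Fin n, ((G.filter fun Φ => skel Φ = S).card : ℝ) ≤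
      2 ^ (m * k) * (1 - (2 : ℝ)⁻¹ ^ k) ^ (m - N) := by
    intro S
    rw [hfib S]
    have key := shwAff_core_count (m := m) (k := k) (n := n) (fun e => S e.1 e.2) N univ
      (fun v b => g (fun i' j' => (S i' j', b (i', j'))) v)
      (fun v x y z => hg S (fun i j => x (i, j)) (fun i j => y (i, j)) (fun i j => z (i, j)) v)
      (hN S)
    rw [card_univ, Fintype.card_fin] at key
    exact key
  have hGsum := Finset.card_eq_sum_card_fiberwise (f := skel) (s := G) (t := univ)
    fun _ _ => mem_coe.2 (mem_univ _)
  have hcard : (Fintype.card (Fin m → Fin k → Fin n × Bool) : ℝ) =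
      (Fintype.card (Fin m → Fin k → Fin n) : ℝ) * 2 ^ (m * k) := by
    rw [Fintype.card_fun, Fintype.card_fun, Fintype.card_prod, Fintype.card_fin, Fintype.card_fin,
      Fintype.card_bool, Fintype.card_fin, Fintype.card_fun, Fintype.card_fun, Fintype.card_fin,
      Fintype.card_fin, Fintype.card_fin]
    push_cast
    rw [mul_pow, mul_pow, ← pow_mul, ← pow_mul, mul_comm k m]
  rw [hGsum, hcard]
  push_cast
  calc ∑ S : Fin m → Fin k → Fin n, ((G.filter fun Φ => skel Φ = S).card : ℝ)
      ≤ ∑ _S : Fin m → Fin k → Fin n, (2 : ℝ) ^ (m * k) * (1 - (2 : ℝ)⁻¹ ^ k) ^ (m - N) :=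
        sum_le_sum fun S _ => hcore S
    _ = (1 - (2 : ℝ)⁻¹ ^ k) ^ (m - N) * ((Fintype.card (Fin m → Fin k → Fin n) : ℝ) *
          2 ^ (m * k)) := by
        rw [sum_const, card_univ, nsmul_eq_mul]
        ring

/-- **Sign-affine maps: the exact finite bound.** If for every variable skeleton `S` the map
`signs ↦ g (S ⊗ signs)` is GF(2)-affine (ternary-xor preserving, output bit by output bit), then
`#{Φ : g Φ satisfies Φ} ≤ (1 - 2^{-k})^{m - n} · #Inst`. -/
theorem shwAff_successCount_le (g : (Fin m → Fin k → Fin n × Bool) → (Fin n → Bool))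
    (hg : ∀ (S : Fin m → Fin k → Fin n) (x y z : Fin m → Fin k → Bool) (v : Fin n),
      g (fun i j => (S i j, (x i j ^^ y i j) ^^ z i j)) v =
        ((g (fun i j => (S i j, x i j)) v ^^ g (fun i j => (S i j, y i j)) v) ^^
          g (fun i j => (S i j, z i j)) v)) :
    (((univ : Finset (Fin m → Fin k → Fin n × Bool)).filter fun Φ =>
        ∀ i, ∃ j, g Φ (Φ i j).1 = (Φ i j).2).card : ℝ) ≤
      (1 - (2 : ℝ)⁻¹ ^ k) ^ (m - n) * Fintype.card (Fin m → Fin k → Fin n × Bool) :=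
  shwAff_successCount_le_of_dep n g hg fun _ =>
    (card_filter_le _ _).trans (by rw [card_univ, Fintype.card_fin])

end Instance

end Summit.PneNP.PneNP.Theorems
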